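import Mathlib.NumberTheory.Height.NumberField
import Mathlib.NumberTheory.NumberField.Discriminant.Different
import Mathlib.NumberTheory.Padics.Complex
import Mathlib.RingTheory.DedekindDomain.FiniteAdeleRing
import Mathlib.Analysis.Complex.Basic
import Literature.NumberTheory.DiophantineGeometry.AbcWave0
import HarnessLib

/-!
# [GenEll] §1 for the projective line minus three points: points of bounded degree, the height,
# log-different and log-conductor functions, compactly bounded subsets

S. Mochizuki, *Arithmetic elliptic curves in general position*, Math. J. Okayama Univ. 52 (2010)
[cite: MochizukiGenEll2010] (kurims manuscript, Feb. 2009, read on the page: Def. 1.1 p. 3,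
arithmetic divisors and `deg_F`, normalised `deg_F := (1/[F:ℚ])·deg_F` and `ht_L̄(x) := deg_F(x_F^* L̄)`
p. 4, Def. 1.2 p. 5, Ex. 1.3 pp. 5–6, Prop. 1.4 p. 6, Def. 1.5 p. 8), SPECIALISED to the one case
the downstream chain [IUTchIV] Cor. 2.2 ⇒ Cor. 2.3 ⇒ abc consumes ([IUTchIV] Cor. 2.2 p. 41:
"Suppose that `X = ℙ¹_ℚ` is the projective line over `ℚ`, and that `D ⊆ X` is the divisor
consisting of the three points "0", "1", and "∞""; [GenEll] Thm. 2.1 (ii) p. 11 is stated for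
exactly this `(P, C)`): `X = P := ℙ¹_ℚ` with its standard model `ℙ¹_ℤ`, `D = C := [0] + [1] + [∞]`,
`U_P := P ∖ C`, affine coordinate `λ` (so `U_P(F) = F ∖ {0, 1}`).

## Modelling decisions (each is a faithful unfolding of the printed definition in this case)

* **Points.** `X(Q̄) = ⋃_{[F:ℚ]<∞} X(F)` (p. 4). A point is presented as a pair `(F, x)`, `F` a
  number field and `x ∈ F` (`NFPoint`); `U_P(Q̄)^{≤d}` (Ex. 1.3 (i) p. 5: "the union of the subsets
  `X(F) ⊆ X(Q̄)` as `F` ranges over the number fields such that `[F : ℚ] ≤ d`") is the set `UPle d`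
  of pairs with `x ≠ 0, 1`, `[F:ℚ] ≤ d` AND `F` a minimal field of definition of `x`, i.e.
  `ℚ(x) = F` (Def. 1.5 (i) p. 8) — the functions of Def. 1.5 are defined through `F_min`, so we
  evaluate every point over its minimal field. (A Q̄-point of degree `e` appears `e·#Aut` times, as
  `(F, σx)`; harmless for statements "`α ≲ β` on a set of points", which are pointwise.)
* **Height** `ht_{ω_P(C)}` (Def. 1.2 (i), Prop. 1.4 (iii)): `ω_{ℙ¹}(C) ≅ 𝒪(1)` has degree `1`
  ([IUTchIV] p. 43: "the line bundle `ω_X(D)` is of degree `1`"), and by Prop. 1.4 (iii) p. 6 "the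
  BD-class of `ht_L̄` depends only on the isomorphism class of the line bundle `L_ℚ`", so
  `[ht_{ω_P(C)}] = [ht_{𝒪(1)}]`; for `𝒪(1)` on `ℙ¹_ℤ` with the standard metric, `ht_{𝒪(1)}(x)` at
  `x = (x : 1)` is the normalised logarithmic Weil height `(1/[F:ℚ])·h_F(x)`. We take THIS
  representative: `NFPoint.ht` := `(1/[F:ℚ]) · logHeight₁ x` (Mathlib's relative height on the
  number field `F`, `NumberField.logHeight₁_eq`). Only its BD-class is ever used downstream.
* **log-different** (Def. 1.5 (iii) p. 8: "the different ideal of `F` determines an effective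
  arithmetic divisor `δ_x` … `log-diff_X(x) := deg_F(δ_x)`", `F` minimal): `deg_F(δ_x) =
  Σ_v ord_v(𝔡_F)·log q_v = log N(𝔡_F)`, so `NFPoint.logDiff := (1/[F:ℚ])·log N(𝔡_{F/ℤ})` with
  Mathlib's `differentIdeal ℤ (𝓞 F)`; `= (1/[F:ℚ])·log |disc F|` (`logDiff_eq_log_discr`,
  Mathlib `NumberField.absNorm_differentIdeal`).
* **log-conductor** (Def. 1.5 (iv) p. 8: pull `D` back along `x : Spec 𝓞_F → X`, take `(D_x)_red`,
  `log-cond_D(x) := deg_F((D_x)_red)`): for the model `(ℙ¹_ℤ, [0]+[1]+[∞])` the support of `D_x` is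
  the set of primes `v` of `F` at which `x` meets `0`, `∞` or `1`, i.e. `ord_v(x) > 0`, `ord_v(x) < 0`
  or `ord_v(x − 1) > 0` (`NFPoint.condSupport`), and `deg_F((D_x)_red) = Σ_{v ∈ supp} log N(v) =
  log ∏_{v ∈ supp} N(v)`; `NFPoint.logCond := (1/[F:ℚ])·log ∏_{v ∈ condSupport} N(v)`. PROVED
  (`condSupport_eq_badPrimes`, `logCond_eq`): the support is exactly the set of "bad primes" of
  the projective point `(x : 1−x : 1)` of the tree's `badPrimes` (Granville–Stark), so
  `log-cond_C(x) = (1/[F:ℚ])·log N_F(x, 1−x, 1)` with the tree's `radicalNorm`.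
* **Compactly bounded subsets** (Ex. 1.3 (ii) pp. 5–6 with [IUTchIV] Rmk. 2.3.1 (vi) p. 56 "the
  compact domain `K_v` … is, in fact, contained in `U(ℂ)` (resp. `U(Q̄_v)`)" and (vii)): `V ⊆ V(ℚ)`
  finite containing `V(ℚ)^arc = {∞}` — recorded by its nonarchimedean part `primes`; bounding
  domains `K_∞ ⊆ X^arc = ℙ¹(ℂ)` (a nonempty `ι`-stable compact domain inside `U(ℂ) = ℂ ∖ {0,1}`) and
  `K_p ⊆ X(Q̄_p)` (nonempty, `Gal(Q̄_p/ℚ_p)`-stable, inside `U(Q̄_p)`, meeting each `X(K)`,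
  `K/ℚ_p` finite, in a compact domain of `X(K)`), with `Q̄_p` = Mathlib's `PadicAlgCl p`; and
  `x ∈ X(F)` lies in `K_V` iff for each `v ∈ V` "the set of `[F:ℚ]` points of `X^arc` (resp.
  `X(Q̄_v)`) determined by `x`" — the images of `x` under the `[F:ℚ]` embeddings `F → ℂ` (resp.
  `F → Q̄_p`) — "is contained in `K_v`" (`CBData`, `CBData.toSet`).

Deliberately NOT here: arithmetic line bundles on general arithmetic surfaces (Def. 1.1), heights
for general `(X, L̄)`, Prop. 1.4 (iv) (Northcott — Mathlib has it for `logHeight₁`), Props. 1.6–1.7,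
and anything about curves other than `ℙ¹ ∖ {0,1,∞}`; the relations `≲/≈` are in
`GenEllBDClasses.lean`; [GenEll] Thm. 2.1 and the abc dictionary are in `GenEllThm21.lean`.
-/

noncomputable section

open NumberField IsDedekindDomain

namespace Literature.NumberTheory.DiophantineGeometry.GenEll

/-- A point of `X(Q̄) = ⋃_{[F:ℚ]<∞} X(F)` for `X = ℙ¹_ℚ`, presented in the affine coordinate `λ`
over a number field: a number field `F` and an element `x ∈ F` (the point `(x : 1) ∈ ℙ¹(F)`; the
point `∞` is not representable and is not needed, being a point of `C`). [GenEll] p. 4: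
"`X(Q̄) = ⋃_{Q̄ ⊇ F, [F:ℚ]<∞} X(F)`". [cite: MochizukiGenEll2010, §1 p.4] -/
structure NFPoint : Type 1 where
  /-- the number field over which the point is presented -/
  F : Type
  [instField : Field F]
  [instNumberField : NumberField F]
  /-- the affine coordinate `λ ∈ F` of the point -/
  x : F

/-- The field structure of the number field over which a point is presented (bundled-structure
projection made available to instance search; it overrides nothing). [cite: MochizukiGenEll2010, §1 p.4] -/
instance NFPoint.field (P : NFPoint) : Field P.F := P.instField

/-- The number-field structure of the field over which a point is presented (bundled-structure
projection; overrides nothing). [cite: MochizukiGenEll2010, §1 p.4] -/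
instance NFPoint.numberField (P : NFPoint) : NumberField P.F := P.instNumberField

namespace NFPoint

/-- The degree `[F : ℚ]` of the field over which the point is presented.
[cite: MochizukiGenEll2010, Ex 1.3 (i) p.5] -/
def degree (P : NFPoint) : ℕ := Module.finrank ℚ P.F

/-- `F` is a minimal field of definition of `x` ([GenEll] Def. 1.5 (i) p. 8: "one obtains a
well-defined minimal field of definition `F_min ⊆ F` of `x` … `F` "is a minimal field of definition
of `x`" [i.e., `F = F_min`]"): for `X = ℙ¹`, `F_min = ℚ(x)`, so the condition is `ℚ(x) = F`.
[cite: MochizukiGenEll2010, Def 1.5 (i) p.8] -/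
def IsMinimal (P : NFPoint) : Prop := IntermediateField.adjoin ℚ ({P.x} : Set P.F) = ⊤

/-- The point lies in `U_P = ℙ¹ ∖ {0, 1, ∞}`: `x ≠ 0` and `x ≠ 1` (and `x ≠ ∞` by construction).
[cite: MochizukiGenEll2010, Thm 2.1 (ii) p.11] -/
def InU (P : NFPoint) : Prop := P.x ≠ 0 ∧ P.x ≠ 1

/-- The degree of a point is positive (`[F:ℚ] ≥ 1`). [cite: MochizukiGenEll2010, Ex 1.3 (i) p.5] -/
theorem degree_pos (P : NFPoint) : 0 < P.degree := Module.finrank_pos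

end NFPoint

/-- `U_P(Q̄)`: the points of `ℙ¹ ∖ {0,1,∞}` over `Q̄`, each presented over its minimal field of
definition (see the module docstring, "Points"). [cite: MochizukiGenEll2010, Ex 1.3 (i) p.5] -/
def UP : Set NFPoint := {P | P.InU ∧ P.IsMinimal}

/-- `U_P(Q̄)^{≤ d} = U_P(Q̄) ∩ X(Q̄)^{≤ d}`, where "`X(Q̄)^{≤d} ⊆ X(Q̄)` [is] the union of the
subsets `X(F) ⊆ X(Q̄)` as `F` ranges over the number fields such that `[F : ℚ] ≤ d`".
[cite: MochizukiGenEll2010, Ex 1.3 (i) p.5] -/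
def UPle (d : ℕ) : Set NFPoint := {P | P ∈ UP ∧ P.degree ≤ d}

/-- `U_P(Q̄)^{≤ d}` grows with `d`. [cite: MochizukiGenEll2010, Ex 1.3 (i) p.5] -/
theorem UPle_mono {d d' : ℕ} (h : d ≤ d') : UPle d ⊆ UPle d' :=
  fun _ hP => ⟨hP.1, hP.2.trans h⟩

/-- `U_P(Q̄)^{≤ d} ⊆ U_P(Q̄)`. [cite: MochizukiGenEll2010, Ex 1.3 (i) p.5] -/
theorem UPle_subset_UP (d : ℕ) : UPle d ⊆ UP := fun _ hP => hP.1

namespace NFPoint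

/-! ## The three functions of [GenEll] §1 on `U_P(Q̄)` -/

/-- The height `ht_{ω_P(C)}(x)` — representative of its BD-class: the normalised logarithmic Weil
height `(1/[F:ℚ]) · h_F(x)`, `h_F(x) = Σ_v log max(1, ‖x‖_v)` (Mathlib `logHeight₁` on the number
field `F`). [GenEll] p. 4: "`ht_M̄(x) := deg_F(x_F^* M̄)`" with the normalised degree
`deg_F = (1/[F:ℚ])·deg_F`; Prop. 1.4 (iii) p. 6: the BD-class depends only on
`L_ℚ ≅ ω_{ℙ¹}(C) ≅ 𝒪(1)`. [cite: MochizukiGenEll2010, Def 1.2 (i) p.5] -/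
def ht (P : NFPoint) : ℝ := (P.degree : ℝ)⁻¹ * Height.logHeight₁ P.x

/-- The log-different `log-diff_X(x) := deg_F(δ_x)`, `δ_x` = the different ideal of `F = F_min` as an
effective arithmetic divisor: `deg_F(δ_x) = Σ_v ord_v(𝔡_F) log q_v = log N(𝔡_F)`, normalised by
`1/[F:ℚ]`. [cite: MochizukiGenEll2010, Def 1.5 (iii) p.8] -/
def logDiff (P : NFPoint) : ℝ :=
  (P.degree : ℝ)⁻¹ * Real.log (Ideal.absNorm (differentIdeal ℤ (𝓞 P.F)))

/-- `log-diff_X(x) = (1/[F:ℚ]) · log |disc(F)|`: the norm of the different is the absolute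
discriminant (Mathlib `NumberField.absNorm_differentIdeal`). [cite: MochizukiGenEll2010, Def 1.5 (iii) p.8] -/
theorem logDiff_eq_log_discr (P : NFPoint) :
    P.logDiff = (P.degree : ℝ)⁻¹ * Real.log ((NumberField.discr P.F).natAbs) := by
  rw [logDiff, NumberField.absNorm_differentIdeal P.F (𝓞 P.F)]

/-- The support of the conductor `(D_x)_red` of `x ∈ U_P(F)` for the model `(ℙ¹_ℤ, [0]+[1]+[∞])`:
the primes `v` of `F` at which `x` meets `0` (`ord_v(x) > 0`, i.e. `|x|_v < 1`), `∞`
(`ord_v(x) < 0`) or `1` (`ord_v(x − 1) > 0`). [cite: MochizukiGenEll2010, Def 1.5 (iv) p.8] -/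
def condSupport (P : NFPoint) : Set (HeightOneSpectrum (𝓞 P.F)) :=
  {v | v.valuation P.F P.x < 1 ∨ 1 < v.valuation P.F P.x ∨ v.valuation P.F (P.x - 1) < 1}

/-- The log-conductor `log-cond_D(x) := deg_F((D_x)_red) = Σ_{v ∈ supp D_x} log N(v)
= log ∏_{v ∈ supp D_x} N(v)`, normalised by `1/[F:ℚ]` (the finite product is Mathlib's `∏ᶠ`; the
support is finite for `x ≠ 0, 1`, `condSupport_finite`). [cite: MochizukiGenEll2010, Def 1.5 (iv) p.8] -/
def logCond (P : NFPoint) : ℝ :=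
  (P.degree : ℝ)⁻¹ * Real.log ((∏ᶠ v ∈ P.condSupport, Ideal.absNorm v.asIdeal : ℕ) : ℝ)

/-- The support of the conductor of `x` at `[0]+[1]+[∞]` is exactly the set of bad primes
(Granville–Stark: primes where the valuations of the three coordinates are not all equal) of the
projective point `(x : 1 − x : 1)` — for every `x ∈ F`. [cite: MochizukiGenEll2010, Def 1.5 (iv) p.8] -/
theorem condSupport_eq_badPrimes (P : NFPoint) : P.condSupport = badPrimes P.x (1 - P.x) 1 := by
  ext v
  simp only [condSupport, badPrimes, Set.mem_setOf_eq, map_one]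
  have hswap : v.valuation P.F (P.x - 1) = v.valuation P.F (1 - P.x) := Valuation.map_sub_swap _ _ _
  constructor
  · rintro (h | h | h) ⟨h1, h2⟩
    · exact absurd (h1.trans h2) (ne_of_lt h)
    · exact absurd (h1.trans h2) (ne_of_gt h)
    · rw [hswap] at h; exact absurd h2 (ne_of_lt h)
  · intro h
    rcases lt_trichotomy (v.valuation P.F P.x) 1 with hlt | heq | hgt
    · exact Or.inl hlt
    · right; right
      rw [hswap]
      have hle : v.valuation P.F (1 - P.x) ≤ 1 := by
        calc v.valuation P.F (1 - P.x) ≤ max (v.valuation P.F 1) (v.valuation P.F P.x) :=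
              Valuation.map_sub _ _ _
          _ = 1 := by rw [map_one, heq, max_self]
      rcases hle.lt_or_eq with hlt' | heq'
      · exact hlt'
      · exact absurd ⟨heq.trans heq'.symm, heq'⟩ h
    · exact Or.inr (Or.inl hgt)

/-- `log-cond_{[0]+[1]+[∞]}(x) = (1/[F:ℚ]) · log N_F(x, 1 − x, 1)`, `N_F` the tree's `radicalNorm`
(product of the norms of the bad primes). [cite: MochizukiGenEll2010, Def 1.5 (iv) p.8] -/
theorem logCond_eq (P : NFPoint) :
    P.logCond = (P.degree : ℝ)⁻¹ * Real.log (radicalNorm P.x (1 - P.x) 1) := by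
  rw [logCond, radicalNorm, condSupport_eq_badPrimes]

/-- For `x ∈ U_P(F)` (`x ≠ 0, 1`) the support of the conductor is finite.
[cite: MochizukiGenEll2010, Def 1.5 (iv) p.8] -/
theorem condSupport_finite (P : NFPoint) (hP : P.InU) : P.condSupport.Finite := by
  have hx : P.x ≠ 0 := hP.1
  have hx1 : P.x - 1 ≠ 0 := sub_ne_zero.mpr hP.2
  -- `{v | 1 < val k}` is finite for every `k` (Mathlib `HeightOneSpectrum.Support.finite`); the three
  -- pieces of the support are of this form for `k = x⁻¹`, `x`, `(x - 1)⁻¹`.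
  have h0 : {v : HeightOneSpectrum (𝓞 P.F) | v.valuation P.F P.x < 1} ⊆
      HeightOneSpectrum.Support (𝓞 P.F) P.x⁻¹ := by
    intro v hv
    simp only [HeightOneSpectrum.Support, Set.mem_setOf_eq, map_inv₀] at hv ⊢
    exact (one_lt_inv₀ (zero_lt_iff.mpr ((Valuation.ne_zero_iff _).mpr hx))).mpr hv
  have h1 : {v : HeightOneSpectrum (𝓞 P.F) | v.valuation P.F (P.x - 1) < 1} ⊆
      HeightOneSpectrum.Support (𝓞 P.F) (P.x - 1)⁻¹ := by
    intro v hv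
    simp only [HeightOneSpectrum.Support, Set.mem_setOf_eq, map_inv₀] at hv ⊢
    exact (one_lt_inv₀ (zero_lt_iff.mpr ((Valuation.ne_zero_iff _).mpr hx1))).mpr hv
  refine (((HeightOneSpectrum.Support.finite (𝓞 P.F) P.x⁻¹).subset h0).union
    (((HeightOneSpectrum.Support.finite (𝓞 P.F) P.x)).union
      ((HeightOneSpectrum.Support.finite (𝓞 P.F) (P.x - 1)⁻¹).subset h1))).subset ?_
  rintro v (hv | hv | hv)
  · exact Or.inl hv
  · exact Or.inr (Or.inl hv)
  · exact Or.inr (Or.inr hv)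

end NFPoint

/-- The `ℚ`-rational point `λ = q` of `ℙ¹`, presented over `ℚ`. [cite: MochizukiGenEll2010, Ex 1.3 (i) p.5] -/
def ratPoint (q : ℚ) : NFPoint where
  F := ℚ
  x := q

/-- A `ℚ`-point has degree `1`. [cite: MochizukiGenEll2010, Ex 1.3 (i) p.5] -/
theorem degree_ratPoint (q : ℚ) : (ratPoint q).degree = 1 := Module.finrank_self ℚ

/-- `ℚ` is a minimal field of definition of each of its points. [cite: MochizukiGenEll2010, Def 1.5 (i) p.8] -/
theorem isMinimal_ratPoint (q : ℚ) : (ratPoint q).IsMinimal := by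
  change IntermediateField.adjoin ℚ ({q} : Set ℚ) = ⊤
  rw [eq_top_iff]
  intro y _
  have h := IntermediateField.algebraMap_mem (IntermediateField.adjoin ℚ ({q} : Set ℚ)) y
  simpa using h

/-- A `ℚ`-point `q ≠ 0, 1` lies in `U_P(Q̄)^{≤ 1}`. [cite: MochizukiGenEll2010, Ex 1.3 (i) p.5] -/
theorem ratPoint_mem_UPle_one {q : ℚ} (h0 : q ≠ 0) (h1 : q ≠ 1) : ratPoint q ∈ UPle 1 :=
  ⟨⟨⟨h0, h1⟩, isMinimal_ratPoint q⟩, (degree_ratPoint q).le⟩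

/-! ## Compactly bounded subsets of `U_P(Q̄)` ([GenEll] Ex. 1.3 (ii); [IUTchIV] Rmk. 2.3.1 (vi), (vii)) -/

/-- The DATA of a compactly bounded subset `K_V ⊆ U_P(Q̄)` ([GenEll] Ex. 1.3 (ii) pp. 5–6, with the
conventions of [IUTchIV] Rmk. 2.3.1 (vi)–(vii) p. 56): a finite set `V` of primes of `ℚ` containing
`V(ℚ)^arc = {∞}` — recorded by its nonarchimedean part `primes` — and bounding domains
`K_∞ ⊆ X^arc = ℙ¹(ℂ)`, "a nonempty `ι_X`-stable compact domain" (compact and equal to the closure of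
its interior) contained in `U(ℂ) = ℂ ∖ {0,1}`, and, for `p ∈ primes`, `K_p ⊆ X(Q̄_p)`, "a nonempty
`Gal(Q̄_p/ℚ_p)`-stable subset whose intersection with each `X(K) ⊆ X(Q̄_p)`, for `K ⊆ Q̄_p` a finite
extension of `ℚ_p`, is a compact domain in `X(K)`", contained in `U(Q̄_p)`; `Q̄_p` is Mathlib's
`PadicAlgCl p`. The values `Knon p` for primes `p ∉ primes` are not used. (The printed conditions
`K_v ≠ X^arc`, `K_v ≠ X(Q̄_v)` follow from `K_v ⊆ U`.) [cite: MochizukiGenEll2010, Ex 1.3 (ii) p.5] -/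
structure CBData : Type 1 where
  /-- the nonarchimedean part of the support `V` -/
  primes : Finset ℕ
  /-- its elements are prime numbers -/
  primes_prime : ∀ p ∈ primes, p.Prime
  /-- the archimedean bounding domain `K_∞ ⊆ ℂ ∖ {0, 1} ⊆ ℙ¹(ℂ)` -/
  Karc : Set ℂ
  /-- the nonarchimedean bounding domains `K_p ⊆ Q̄_p ∖ {0, 1} ⊆ ℙ¹(Q̄_p)` -/
  Knon : (p : ℕ) → [Fact p.Prime] → Set (PadicAlgCl p)
  /-- `K_∞` is nonempty -/
  Karc_nonempty : Karc.Nonempty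
  /-- `K_∞` is compact -/
  Karc_isCompact : IsCompact Karc
  /-- `K_∞` is a compact DOMAIN: equal to the closure of its interior -/
  Karc_closure_interior : closure (interior Karc) = Karc
  /-- `K_∞` is stable under complex conjugation `ι_X` -/
  Karc_conj : ∀ z ∈ Karc, (starRingEnd ℂ) z ∈ Karc
  /-- `K_∞ ⊆ U(ℂ)` ([IUTchIV] Rmk. 2.3.1 (vi)) -/
  Karc_subset : Karc ⊆ {z | z ≠ 0 ∧ z ≠ 1}
  /-- `K_p` is nonempty -/
  Knon_nonempty : ∀ p ∈ primes, ∀ [Fact p.Prime], (Knon p).Nonempty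
  /-- `K_p` is `Gal(Q̄_p/ℚ_p)`-stable -/
  Knon_galois : ∀ p ∈ primes, ∀ [Fact p.Prime], ∀ σ : PadicAlgCl p ≃ₐ[ℚ_[p]] PadicAlgCl p,
    ∀ y ∈ Knon p, σ y ∈ Knon p
  /-- `K_p ∩ X(K)` is a compact domain in `X(K)` for every finite extension `K/ℚ_p` inside `Q̄_p`
  (compactness and closure-of-interior taken in `K` with its `p`-adic topology) -/
  Knon_compactDomain : ∀ p ∈ primes, ∀ [Fact p.Prime], ∀ K : IntermediateField ℚ_[p] (PadicAlgCl p),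
    FiniteDimensional ℚ_[p] K →
      IsCompact {y : K | (y : PadicAlgCl p) ∈ Knon p} ∧
        closure (interior {y : K | (y : PadicAlgCl p) ∈ Knon p}) = {y : K | (y : PadicAlgCl p) ∈ Knon p}
  /-- `K_p ⊆ U(Q̄_p)` ([IUTchIV] Rmk. 2.3.1 (vi)) -/
  Knon_subset : ∀ p ∈ primes, ∀ [Fact p.Prime], Knon p ⊆ {y | y ≠ 0 ∧ y ≠ 1}

namespace CBData

/-- Membership of a point `x ∈ X(F)` in the compactly bounded subset `K_V`: "for each
`v ∈ V^arc` (resp. `v ∈ V^non`), the set of `[F : ℚ]` points of `X^arc` (resp. `X(Q̄_v)`) determined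
by `x`" — its images under the embeddings `F → ℂ` (resp. `F → Q̄_p`) — "is contained in `K_v`".
[cite: MochizukiGenEll2010, Ex 1.3 (ii) p.6] -/
def Mem (D : CBData) (P : NFPoint) : Prop :=
  (∀ σ : P.F →+* ℂ, σ P.x ∈ D.Karc) ∧
    ∀ p ∈ D.primes, ∀ [Fact p.Prime], ∀ σ : P.F →+* PadicAlgCl p, σ P.x ∈ D.Knon p

/-- The compactly bounded subset `K_V ⊆ X(Q̄)` determined by the data `(V, {K_v})`, as a set of
presented points. [cite: MochizukiGenEll2010, Ex 1.3 (ii) p.6] -/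
def toSet (D : CBData) : Set NFPoint := {P | D.Mem P}

/-- Unfolding lemma for membership in `K_V`. [cite: MochizukiGenEll2010, Ex 1.3 (ii) p.6] -/
theorem mem_toSet_iff (D : CBData) (P : NFPoint) : P ∈ D.toSet ↔ D.Mem P := Iff.rfl

/-- "The support of the compactly bounded subset contains `Σ`" for a finite set `Σ` of prime
numbers ([GenEll] Thm. 2.1 (ii) p. 11: "a compactly bounded subset whose support contains `Σ`";
the support always contains `∞`). [cite: MochizukiGenEll2010, Thm 2.1 (ii) p.11] -/
def SupportContains (D : CBData) (S : Finset ℕ) : Prop := S ⊆ D.primes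

/-- A point of `K_V` has all its complex conjugates in `K_∞ ⊆ ℂ ∖ {0,1}`; in particular it lies in
`U_P`. [cite: MochizukiGenEll2010, Ex 1.3 (ii) p.6] -/
theorem inU_of_mem {D : CBData} {P : NFPoint} (h : D.Mem P) : P.InU := by
  obtain ⟨σ⟩ : Nonempty (P.F →+* ℂ) := inferInstance
  have hσ := D.Karc_subset (h.1 σ)
  exact ⟨fun h0 => hσ.1 (by rw [h0, map_zero]), fun h1 => hσ.2 (by rw [h1, map_one])⟩

end CBData

end Literature.NumberTheory.DiophantineGeometry.GenEll

end
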